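import Mathlib
import Literature.MathematicalPhysics.QuantumFieldTheory.Balaban1983to89.B11

/-!
# `Balaban1983to89.B11Thm1` — Theorem 1 of [Balaban1985Variational] (cell paper B11): the displayed clauses (8),
(9), (10) as named `Prop`s, and the printed INDUCTION ON k (p. 279 and Sect. A, pp. 279–280) kernel-checked over
named, verbatim-quoted leaves

T. Bałaban, *The variational problem and background fields in renormalization group method for lattice gauge
theories*, Commun. Math. Phys. **102**, 277–309 (1985), doi:10.1007/bf01229381.  PDF held:
`paper:balaban1985-cmp102-variational-background` (journal page = PDF page + 276).

CITATION HEADER (lean-in-tree rule 2026-08-18).  This module is a TYPED SKELETON (statement level + paper-internal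
bookkeeping) of the published paper [Balaban1985Variational]; it is a SIBLING of `…Balaban1983to89.B11` (reader r2 +
surge sub-cell b2b-balaban-b11), which it imports and does not modify.  WHAT IS REPRODUCED: (§1) the three conclusions
of Theorem 1 p. 279 — existence of a minimal orbit in the space (8), uniqueness of the critical orbit in the space (6),
and the regularity inequalities (9), (10) — as separately named `Prop`s (`Exists8`, `Unique6`, `Ineq9`, `Ineq10`,
`Reg910`, `Thm1At`) with the kernel-checked identities `regularity_iff`, `thm1Printed_iff` against r2's bundled
`B11.Regularity`, `B11.Thm1Printed` (so that a consumer can cite one displayed inequality, or Theorem 1 at GIVEN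
constants, by name); (§2) the printed proof ARCHITECTURE of Theorem 1 which `B11.thm1_of_prop7_prop8_sectF` (Thm 1 ⇐
Prop 7 ∧ Prop 8 ∧ Sect. F) leaves inside its leaves: p. 279 *"Theorem 1 will be proved by induction with respect to k.
… The first step of the proof, for k = 1, will be covered by the proof of a general case"* and Sect. A (11)–(14),
pp. 279–280 (the background configuration U₀ = U_{k−1}(V₀) supplied by Theorem 1 at level k − 1, *"(14) with
C₁ = L³"*, and *"for k = 1 … we take simply U₀ = V₀"*), typed as verbatim-quoted leaves over a scale tower of r2's
carriers and assembled by a kernel-checked induction on k in which the constants a₀, a₁, B₃, B₄, M(·) are fixed BEFORE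
k (the printed uniformity "The constants a₀, a₁, B₃, depend on d and L only").  NOTHING of the series is asserted:
every leaf `def … : Prop` is used only as a hypothesis; the located gaps are the cell's GAPS.md rows G-B11-A1 (leaf
`StepA11`), G-B11-A2 (leaf `BaseK1`), C-pv12-2 (leaf `StepA13`), G-pv12-1 (Prop. 7 is proved FROM a background (14),
leaf `Prop7From14`), and the rows cited in the docstrings of `B11.Prop7Printed`, `B11.Prop8Printed`,
`B11.SectFPrinted`.  Value = typed skeleton + located gaps, NOT summit progress.  Unit `b2b-balaban-pv12` (surge node
prover #12, cell row T07.1); staged byte-identically in the cell package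
`run/shared/lean/pub/pub-balaban/lean/BalabanYm4/Literature/…/B11Thm1.lean`; typed readings DIVERGENCE.md D-pv12.1–2.
-/

namespace Literature.MathematicalPhysics.QuantumFieldTheory.Balaban1983to89.B11Thm1

open Literature.MathematicalPhysics.QuantumFieldTheory.Balaban1983to89.B11

/-! ## §1. The displayed clauses of Theorem 1 (p. 279 [3]) as named `Prop`s -/

/-- **(9)** p. 279 [3], verbatim, for the field A of U^{u⁻¹} = e^{iηA} on a cube □ of size 2ML^jη:
*"|A| < B₃Mε₁(L^jη)^{−1}, |∇^ηA| < B₃Mε₁(L^jη)^{−2}, ‖A‖_{1,β} < B₄(β₀)Mε₁(L^jη)^{−2−β} for 0 ≤ β ≤ β₀ = 1, (9)"* —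
the three inequalities of the display (9), over r2's carrier `B11.VarProblem` (M = `sizeM □`, j = `scale □`).
[cite: Balaban1985Variational, (9) p.279] -/
def Ineq9 (P : VarProblem) (B₃ B₄ ε₁ : ℝ) (U : P.Cfg) (c : P.Cube) : Prop :=
  P.normA U c < B₃ * P.sizeM c * ε₁ * (P.L ^ P.scale c * P.eta)⁻¹ ^ 1 ∧
  P.normGradA U c < B₃ * P.sizeM c * ε₁ * (P.L ^ P.scale c * P.eta)⁻¹ ^ 2 ∧
  (∀ β : ℝ, 0 ≤ β → β ≤ 1 →
    P.holderA U c β < B₄ * P.sizeM c * ε₁ * ((P.L ^ P.scale c * P.eta)⁻¹) ^ (2 + β))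

/-- **(10)** p. 279 [3], verbatim: *"|∂^{η*}∂^ηA|, |Δ^ηA| < B₃Mε₁(L^jη)^{−3}. (10)"* (r2's field `normLapA` = the
larger of the two printed left-hand sides). [cite: Balaban1985Variational, (10) p.279] -/
def Ineq10 (P : VarProblem) (B₃ ε₁ : ℝ) (U : P.Cfg) (c : P.Cube) : Prop :=
  P.normLapA U c < B₃ * P.sizeM c * ε₁ * (P.L ^ P.scale c * P.eta)⁻¹ ^ 3

/-- r2's bundled `B11.Regularity` is exactly: the gauge u exists on a neighbourhood of □ (`Gauged`) ∧ (9) ∧ (10).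
[folklore] -/
theorem regularity_iff (P : VarProblem) (B₃ B₄ ε₁ : ℝ) (U : P.Cfg) (c : P.Cube) :
    Regularity P B₃ B₄ ε₁ U c ↔ P.Gauged U c ∧ Ineq9 P B₃ B₄ ε₁ U c ∧ Ineq10 P B₃ ε₁ U c := by
  simp only [Regularity, Ineq9, Ineq10, and_assoc]

/-- **(8)**, the existence clause of Theorem 1 p. 279 [3], verbatim: *"for an arbitrary configuration V satisfying (7)
with ε₁ ≤ a₁ there exists a minimal orbit in the space 𝔘_k({Ω_j}, B₃ε₁) ∩ 𝔅_k(𝔅_k, V). (8)"* — for one V: a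
configuration U in the space (8) lying on a minimal orbit of (5) in (8). [cite: Balaban1985Variational, (8) p.279] -/
def Exists8 (P : VarProblem) (B₃ ε₁ : ℝ) (V : P.Bdry) : Prop :=
  ∃ U : P.Cfg, P.InU (B₃ * ε₁) U ∧ P.InB V U ∧ P.OnMinimalOrbit (B₃ * ε₁) V U

/-- The uniqueness clause of Theorem 1 p. 279 [3], verbatim: *"This orbit is a unique critical orbit in the space (6)
if B₃ε₁ ≤ ε₀ and ε₀ ≤ a₀."* [cite: Balaban1985Variational, Thm 1 p.279] -/
def Unique6 (P : VarProblem) (a₀ B₃ ε₁ : ℝ) (V : P.Bdry) : Prop :=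
  ∀ ε₀ : ℝ, B₃ * ε₁ ≤ ε₀ → ε₀ ≤ a₀ → ∀ U, P.OnMinimalOrbit (B₃ * ε₁) V U → P.UniqueCriticalOrbit ε₀ V U

/-- The regularity clause of Theorem 1 p. 279 [3], verbatim: *"The minimal configurations U have the following
regularity properties: for an arbitrary cube □ in the class described above, of a size 2ML^jη, M ≤ M(ε₁), there
exists a gauge transformation u defined on a neighborhood of □ and such that on □, U^{u⁻¹} = e^{iηA}, [(9), (10)]"*,
with the bound M(ε₁) displayed as the parameter `M`. [cite: Balaban1985Variational, Thm 1 p.279] -/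
def Reg910 (P : VarProblem) (B₃ B₄ ε₁ M : ℝ) (V : P.Bdry) : Prop :=
  ∀ U, P.OnMinimalOrbit (B₃ * ε₁) V U → ∀ c : P.Cube, P.sizeM c ≤ M → Regularity P B₃ B₄ ε₁ U c

/-- The constants of Theorem 1 p. 279 [3], verbatim: *"There exist positive constants a₀, a₁, B₃, B₄(β₀), M(ε₁),
B₃a₁ ≤ a₀ … The constants a₀, a₁, B₃, depend on d and L only, the constants B₄(β₀), M(ε₁) depend on the indicated
parameters also. More exactly M(ε₁) = R₁M₁(a₁/ε₁)."* — packaged (β₀ = 1 fixed, M(·) = `Mfun`) so that Theorem 1 AT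
GIVEN CONSTANTS (`Thm1At`) can be named: the induction on k of Sect. A is on that statement, not on `∃ constants, …`.
[cite: Balaban1985Variational, Thm 1 p.279] -/
structure Consts where
  a₀ : ℝ
  a₁ : ℝ
  B₃ : ℝ
  B₄ : ℝ
  Mfun : ℝ → ℝ
  a₀_pos : 0 < a₀
  a₁_pos : 0 < a₁
  B₃_pos : 0 < B₃
  B₄_pos : 0 < B₄
  B₃a₁_le : B₃ * a₁ ≤ a₀
  Mfun_pos : ∀ e, 0 < e → 0 < Mfun e

/-- **Theorem 1 at given constants** for ONE variational problem (one datum (k; {Ω_j}; 𝔅_k)): the body of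
`B11.Thm1Printed` after its existential quantifier over the constants — for every ε₁ ≤ a₁ and every V with (7):
(8) ∧ uniqueness in (6) ∧ regularity (9), (10) for cubes with M ≤ M(ε₁). [cite: Balaban1985Variational, Thm 1 p.279] -/
def Thm1At (C : Consts) (P : VarProblem) : Prop :=
  ∀ ε₁ : ℝ, 0 < ε₁ → ε₁ ≤ C.a₁ → ∀ V : P.Bdry, P.Reg7 ε₁ V →
    Exists8 P C.B₃ ε₁ V ∧ Unique6 P C.a₀ C.B₃ ε₁ V ∧ Reg910 P C.B₃ C.B₄ ε₁ (C.Mfun ε₁) V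

/-- r2's `B11.Thm1Printed fam` (constants chosen before the instance `i : I`) is exactly "one block of constants such
that Theorem 1 at those constants holds for every member of the family". [folklore] -/
theorem thm1Printed_iff {I : Type} (fam : I → VarProblem) :
    Thm1Printed fam ↔ ∃ C : Consts, ∀ i, Thm1At C (fam i) := by
  constructor
  · rintro ⟨a₀, a₁, B₃, B₄, Mfun, ha₀, ha₁, hB₃, hB₄, hle, hM, H⟩
    exact ⟨⟨a₀, a₁, B₃, B₄, Mfun, ha₀, ha₁, hB₃, hB₄, hle, hM⟩, fun i ε₁ h₁ h₂ V hV => H i ε₁ h₁ h₂ V hV⟩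
  · rintro ⟨C, H⟩
    exact ⟨C.a₀, C.a₁, C.B₃, C.B₄, C.Mfun, C.a₀_pos, C.a₁_pos, C.B₃_pos, C.B₄_pos, C.B₃a₁_le, C.Mfun_pos,
      fun i ε₁ h₁ h₂ V hV => H i ε₁ h₁ h₂ V hV⟩

/-! ## §2. The induction on k (p. 279) and the reduction of Sect. A ((11)–(14), pp. 279–280)

p. 279 [3], verbatim: *"Theorem 1 will be proved by induction with respect to k. In the course of the proof the
constants B₃, B₄ will be described explicitly. The first step of the proof, for k = 1, will be covered by the proof of
a general case."*  Sect. A, pp. 279–280 [3–4], verbatim: *"We start a proof of Theorem 1 for some k assuming that it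
is true for k − 1. We have a configuration V defined on 𝔅_k and satisfying (7). The set 𝔅_k determines the following
set 𝔅′_{k−1} = ⋃_{j=0}^{k−1} Λ′_j: Λ′_j = Λ_j for j = 0, 1, …, k − 2, Λ′_{k−1} = Λ_{k−1} ∪ B(Λ_k). We can easily
construct a configuration V₀ on 𝔅′_{k−1} such that it satisfies (7) on 𝔅′_{k−1}, and V₀ = V on ⋃_{j=0}^{k−1} Λ_j,
V̄₀ = V on Λ_k. (11) For example we can take V_{0,b} = V_{b′}, for b ∈ B(b′), b′ ∈ Λ_k and V_{0,b} = 1 for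
remaining bonds of B(Λ_k). We assume that ε₁ ≤ a₁, B₃ε₁ ≤ ε₀ ≤ a₀ and we use the inductive assumption, i.e. we apply
the Theorem 1 for k − 1 and the configuration V₀. We get a minimal configuration U₀ = U_{k−1}(V₀) belonging to the
space 𝔘_{k−1}({Ω_j}, B₃ε₁) ∩ 𝔅_{k−1}(𝔅′_{k−1}, V₀). (12) From the conditions (11), and from the form (2) of the
regularity conditions, it follows that U₀ ∈ 𝔘_k({Ω_j}, B₃L³ε₁) ∩ 𝔅_k(𝔅_k, V), (13) hence U₀ should be close to the
minimal configuration we are looking for. … Having in view future applications we will consider a little bit more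
general configuration U₀ than this constructed above. We assume that we have a configuration U₀ satisfying
U₀ ∈ 𝔘_k({Ω_j}, C₁B₃ε₁), |Ū₀^j − V| < C₁ε₁ on Λ_j, j = 0, 1, …, k, (14) for some absolute constant C₁. The
configuration U₀ constructed above satisfies (14) with C₁ = L³. Let us notice that for k = 1 we do not have any
solutions of the variational problem yet, and then we take simply U₀ = V₀, V₀ constructed above."*

Typed reading (DIVERGENCE D-pv12.1): the levels are indexed by `n : ℕ` ↔ printed k = n + 1; the level-(k − 1)
problem determined by a level-k datum lives on the SAME lattice Ω₀ (the sequence {Ω_j} is one shorter, 𝔅_k is replaced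
by 𝔅′_{k−1}), so the maps datum ↦ datum (`drop`), V ↦ V₀ (`V0`, one printed choice) and "a configuration of the
level-(k − 1) problem is a configuration on Ω₀ of the level-k problem" (`lift`, the identity in the model) are DATA
of the tower, and their printed PROPERTIES (11) ⇒ (7), (12) ⇒ (13) and the k = 1 sentence are the leaves `StepA11`,
`StepA13`, `BaseK1` — hypotheses, never asserted. -/

/-- r2's carrier `B11.VarProblem`, with b11's notions `IsCritical`, `SameOrbit` (`B11.VarProblemX`), extended by the
second condition of (14) p. 280 [4]: `Near b V U` ↔ *"|Ū^j − V| < b on Λ_j, j = 0, 1, …, k"* — so that hypothesis (14)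
is typed with its two parameters exactly as `B11.LGData.Sat14` reads it on the Landau-gauge carrier of Sects. A–E
(DIVERGENCE D-pv12.2). [cite: Balaban1985Variational, (14) p.280] -/
structure VarProblemA extends VarProblemX where
  Near : ℝ → Bdry → Cfg → Prop

/-- **(14)** p. 280 [4], verbatim: *"U₀ ∈ 𝔘_k({Ω_j}, C₁B₃ε₁), |Ū₀^j − V| < C₁ε₁ on Λ_j, j = 0, 1, …, k, (14) for some
absolute constant C₁."* [cite: Balaban1985Variational, (14) p.280] -/
def VarProblemA.Sat14 (P : VarProblemA) (C₁ B₃ ε₁ : ℝ) (V : P.Bdry) (U₀ : P.Cfg) : Prop :=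
  P.InU (C₁ * B₃ * ε₁) U₀ ∧ P.Near (C₁ * ε₁) V U₀

/-- The dictionary laws of the intended model used by the bookkeeping below — hypotheses, never asserted: b11's
`B11.VarProblemX.Laws` (i)–(iv), and (v) membership in 𝔅_k(𝔅_k, V), i.e. condition (3) "Ū^j = V on Λ_j", gives
|Ū^j − V| = 0 < b on Λ_j for every b > 0 (used once: (13) ⇒ (14)). [folklore] -/
def VarProblemA.LawsA (P : VarProblemA) : Prop :=
  P.toVarProblemX.Laws ∧ ∀ (b : ℝ) (V : P.Bdry) (U : P.Cfg), 0 < b → P.InB V U → P.Near b V U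

/-- The scale tower of the induction on k (p. 279, Sect. A) for fixed (d, L): `I n` indexes the level-(n + 1) data
(k = n + 1; {Ω_j}_{j ≤ k}; 𝔅_k) and `fam n i` is the variational problem (5), (6) of that datum on r2's carrier;
`L` = the block size L of the series (C₁ = L³ in (14)); `drop n i` = the level-k datum determined by the level-(k + 1)
datum i (p. 279: "The set 𝔅_k determines the following set 𝔅′_{k−1} …", the sequence {Ω_j} shortened by one);
`V0 n i V` = the configuration V₀ of (11) on 𝔅′ built from V; `lift n i` = a configuration of the problem `drop n i`
regarded as a configuration on Ω₀ of the problem i (same lattice; the identity in the model); `base i V` = for k = 1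
the configuration V₀ of (11) on 𝔅′₀ = Λ₀ ∪ B(Λ₁) regarded as a configuration on Ω₀ (p. 280: "for k = 1 … we take
simply U₀ = V₀").  Data only; their printed properties are the leaves below (DIVERGENCE D-pv12.1).
[cite: Balaban1985Variational, Sect. A pp.279–280] -/
structure Tower where
  I : ℕ → Type
  fam : (n : ℕ) → I n → VarProblemA
  L : ℝ
  drop : (n : ℕ) → I (n + 1) → I n
  V0 : (n : ℕ) → (i : I (n + 1)) → (fam (n + 1) i).Bdry → (fam n (drop n i)).Bdry
  lift : (n : ℕ) → (i : I (n + 1)) → (fam n (drop n i)).Cfg → (fam (n + 1) i).Cfg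
  base : (i : I 0) → (fam 0 i).Bdry → (fam 0 i).Cfg

/-- All levels of the tower as ONE family of r2's carriers (index = ⟨level, datum⟩): Theorem 1 over this family
(`B11.Thm1Printed T.famAll`) is Theorem 1 with constants uniform in k. [folklore] -/
abbrev Tower.famAll (T : Tower) : (Σ n, T.I n) → VarProblem := fun p => (T.fam p.1 p.2).toVarProblem

/-- All levels of the tower as one family of b11's carriers (for `B11.Prop8Printed`, `B11.SectFPrinted`, whose
constants are then automatically the same at every level). [folklore] -/
abbrev Tower.famAllX (T : Tower) : (Σ n, T.I n) → VarProblemX := fun p => (T.fam p.1 p.2).toVarProblemX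

/-- Leaf **(11)** p. 279 [3], verbatim: *"We can easily construct a configuration V₀ on 𝔅′_{k−1} such that it
satisfies (7) on 𝔅′_{k−1}, and V₀ = V on ⋃_{j=0}^{k−1} Λ_j, V̄₀ = V on Λ_k. (11)"* — typed: if V satisfies (7) with ε₁
for the level-(k + 1) datum then V₀ satisfies (7) with the same ε₁ for the level-k datum.  GAPS G-B11-A1 (b11): that the
printed choice of V₀ satisfies (7) on the new bonds of Λ′_{k−1} = Λ_{k−1} ∪ B(Λ_k) is asserted ("easily"), not shown.
[cite: Balaban1985Variational, (11) p.279] -/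
def StepA11 (T : Tower) : Prop :=
  ∀ (n : ℕ) (i : T.I (n + 1)) (ε₁ : ℝ) (V : (T.fam (n + 1) i).Bdry),
    (T.fam (n + 1) i).Reg7 ε₁ V → (T.fam n (T.drop n i)).Reg7 ε₁ (T.V0 n i V)

/-- Leaf **(12) ⇒ (13)** p. 280 [4], verbatim: *"We get a minimal configuration U₀ = U_{k−1}(V₀) belonging to the space
𝔘_{k−1}({Ω_j}, B₃ε₁) ∩ 𝔅_{k−1}(𝔅′_{k−1}, V₀). (12) From the conditions (11), and from the form (2) of the regularity
conditions, it follows that U₀ ∈ 𝔘_k({Ω_j}, B₃L³ε₁) ∩ 𝔅_k(𝔅_k, V), (13)"* — typed for every configuration of the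
space (12) (the printed inference uses membership only, not minimality), with B₃L³ε₁ written L³·B₃·ε₁ (= C₁B₃ε₁,
C₁ = L³, the order of (14)).  The arithmetic behind "the form (2)" — on Ω_k ⊂ Ω_{k−1} the level-(k − 1) bounds of (2)
at j = k − 1 are the level-k bounds at j = k times L² (plaquettes) resp. L³ (covariant derivative), both ≤ L³ —
is reproduced below (`ineq13_plaquette_factor`, `ineq13_bond_factor`, `sq_le_cube_of_one_le`); census C-pv12-2.
[cite: Balaban1985Variational, (12)–(13) p.280] -/
def StepA13 (T : Tower) (B₃ : ℝ) : Prop :=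
  ∀ (n : ℕ) (i : T.I (n + 1)) (ε₁ : ℝ) (V : (T.fam (n + 1) i).Bdry) (U : (T.fam n (T.drop n i)).Cfg),
    (T.fam (n + 1) i).Reg7 ε₁ V →
    (T.fam n (T.drop n i)).InU (B₃ * ε₁) U → (T.fam n (T.drop n i)).InB (T.V0 n i V) U →
      (T.fam (n + 1) i).InU (T.L ^ 3 * B₃ * ε₁) (T.lift n i U) ∧ (T.fam (n + 1) i).InB V (T.lift n i U)

/-- Leaf **k = 1** p. 280 [4], verbatim: *"Let us notice that for k = 1 we do not have any solutions of the variational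
problem yet, and then we take simply U₀ = V₀, V₀ constructed above."* — read with the standing assumption (14) and
*"The configuration U₀ constructed above satisfies (14) with C₁ = L³"*: at level k = 1, for V with (7), U₀ = V₀
satisfies (14) with C₁ = L³.  GAPS G-B11-A2 (b11): only partially verifiable from (7) as printed (`B11.B3_lower_bounds`
records what B₃ ≥ 72d³L³B₀ of (162) gives); a hypothesis here. [cite: Balaban1985Variational, p.280] -/
def BaseK1 (T : Tower) (B₃ : ℝ) : Prop :=
  ∀ (i : T.I 0) (ε₁ : ℝ) (V : (T.fam 0 i).Bdry), 0 < ε₁ → (T.fam 0 i).Reg7 ε₁ V →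
    (T.fam 0 i).Sat14 (T.L ^ 3) B₃ ε₁ V (T.base i V)

/-- **Proposition 7 as PROVED** (Sects. A–E under the standing assumption (14)).  Printed statement p. 299 [23],
verbatim: *"Proposition 7. There exist positive, absolute constants a₀, a′₁ such that for ε₀ ≤ a₀ and B₃ε₁ ≤ ε₀ the
variational problem (5), (6) has at most one critical orbit. If ε₁ ≤ a′₁, then there exists a minimal orbit in the
space (6) with ε₀ = O(1)C₁B₃ε₁."* — typed exactly as b11's `B11.Prop7Printed` but WITH the background U₀ of (14) as a
hypothesis, uniformly over all levels of the tower: the printed proof runs through Propositions 2, 5, 6 (stated for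
"U₀ satisfies (14)", pp. 281, 296: *"by Propositions 5 and 6 there is at most one critical configuration of (5) in
(19)–(21)"*) and p. 299: *"Now we take the configuration U₁U₀ … Let us define U_k = (U₁U₀)^u. Proposition 7 [6]
implies that U_k belongs to the space (18) with ε₀ = O(1)C₁B₃ε₁. It is a critical configuration of the functional
(5)."*  GAPS G-pv12-1: the printed Proposition 7 is background-free, the proved one is not — at level k it presupposes
Theorem 1 at level k − 1 (through (12)–(14)); `prop7Printed_of_from14` records the exact relation.
[cite: Balaban1985Variational, Prop. 7 p.299] -/
def Prop7From14 (T : Tower) (B₃ C₁ : ℝ) : Prop :=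
  ∃ a₀ a₁' O₁ : ℝ, 0 < a₀ ∧ 0 < a₁' ∧ 0 < O₁ ∧
    ∀ (n : ℕ) (i : T.I n) (ε₀ ε₁ : ℝ), 0 < ε₁ → ∀ V : (T.fam n i).Bdry, (T.fam n i).Reg7 ε₁ V →
      ∀ U₀ : (T.fam n i).Cfg, (T.fam n i).Sat14 C₁ B₃ ε₁ V U₀ →
        (ε₀ ≤ a₀ → B₃ * ε₁ ≤ ε₀ → (T.fam n i).toVarProblemX.AtMostOneCriticalOrbit ε₀ V) ∧
        (ε₁ ≤ a₁' → ∃ U : (T.fam n i).Cfg, (T.fam n i).OnMinimalOrbit (O₁ * C₁ * B₃ * ε₁) V U)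

/-- The printed (background-free) Proposition 7, b11's `B11.Prop7Printed` over all levels, follows from the proved one
(`Prop7From14`) as soon as every V with (7) admits a background U₀ with (14) — which is what the induction supplies
(GAPS G-pv12-1). [folklore] -/
theorem prop7Printed_of_from14 (T : Tower) (B₃ C₁ : ℝ) (h7 : Prop7From14 T B₃ C₁)
    (hbg : ∀ (n : ℕ) (i : T.I n) (ε₁ : ℝ) (V : (T.fam n i).Bdry), 0 < ε₁ → (T.fam n i).Reg7 ε₁ V →
      ∃ U₀ : (T.fam n i).Cfg, (T.fam n i).Sat14 C₁ B₃ ε₁ V U₀) :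
    Prop7Printed B₃ C₁ T.famAllX := by
  obtain ⟨a₀, a₁', O₁, ha₀, ha₁', hO₁, H7⟩ := h7
  refine ⟨a₀, a₁', O₁, ha₀, ha₁', hO₁, ?_⟩
  intro p ε₀ ε₁ hε₁ V hV
  obtain ⟨U₀, h14⟩ := hbg p.1 p.2 ε₁ V hε₁ hV
  exact H7 p.1 p.2 ε₀ ε₁ hε₁ V hV U₀ h14

/-- The arithmetic of "the form (2)" behind (13), plaquette part: for p ∈ Ω_{j+1} ⊂ Ω_j the bound of (2) at scale j,
e·η²(L^jη)^{−2}, is L² times the bound at scale j + 1 (same η, same e). [folklore] -/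
theorem ineq13_plaquette_factor (L η e : ℝ) (j : ℕ) (hL : L ≠ 0) (hη : η ≠ 0) :
    e * η ^ 2 * (L ^ j * η)⁻¹ ^ 2 = L ^ 2 * (e * η ^ 2 * (L ^ (j + 1) * η)⁻¹ ^ 2) := by
  field_simp
  ring

/-- The arithmetic of "the form (2)" behind (13), covariant-derivative part: for b ∈ Ω_{j+1} ⊂ Ω_j the bound of (2) at
scale j, e·η²(L^jη)^{−3}, is L³ times the bound at scale j + 1 — the printed C₁ = L³ of (13)/(14). [folklore] -/
theorem ineq13_bond_factor (L η e : ℝ) (j : ℕ) (hL : L ≠ 0) (hη : η ≠ 0) :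
    e * η ^ 2 * (L ^ j * η)⁻¹ ^ 3 = L ^ 3 * (e * η ^ 2 * (L ^ (j + 1) * η)⁻¹ ^ 3) := by
  field_simp
  ring

/-- … and L² ≤ L³ for L ≥ 1, so the single constant C₁ = L³ dominates both factors (with 𝔘_k(e) ⊂ 𝔘_k(e′) for
e ≤ e′, law (i)). [folklore] -/
theorem sq_le_cube_of_one_le (L : ℝ) (hL : 1 ≤ L) : L ^ 2 ≤ L ^ 3 :=
  calc L ^ 2 = L ^ 2 * 1 := (mul_one _).symm
    _ ≤ L ^ 2 * L := mul_le_mul_of_nonneg_left hL (sq_nonneg L)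
    _ = L ^ 3 := by ring

/-- **Theorem 1 at one level ⇐ a background with (14)** — the content of Sects. B–F as organised on p. 281 ("This
will prove Theorem 1 with worse bounds. Next we will improve the bounds and we will complete the proof of this
theorem"), p. 299 and pp. 304–305 (*"We have constructed the minimal configuration U_k in the space (2) with
ε₀ = O(1)B₃ε₁, hence we have the additional restriction on ε₁: O(1)B₃ε₁ ≤ a₅. Now we define a₁ as a largest constant
such, that the restriction ε₁ ≤ a₁ implies all the other restrictions we have imposed on ε₁. Especially it implies
that U_k is in the space (8)."*; p. 305: *"hence we have proved the regularity conditions (9), (10), and the proof of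
Theorem 1 is completed."*): for V with (7), 0 < ε₁ ≤ a₁ := min{a′₁, a₁(F), a₅/(O(1)C₁B₃), a₀/B₃} and a background
U₀ with (14), the three conclusions of Theorem 1 hold at the constants (a₀, B₃, B₄, M(ε₁) = R₁M₁(a₁/ε₁)) — b11's
assembly `B11.thm1_of_prop7_prop8_sectF` with the background threaded through Proposition 7. [folklore] -/
theorem thm1_clauses_of_background (T : Tower) (B₃ C₁ a₀ a₁' O₁ a₅ aF B₄ RM a₁ : ℝ)
    (hK : 0 < O₁ * C₁ * B₃) (hRM : 0 < RM)
    (h1 : a₁ ≤ a₁') (h2 : a₁ ≤ aF) (h3 : a₁ ≤ a₅ / (O₁ * C₁ * B₃))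
    (laws : ∀ n i, (T.fam n i).LawsA)
    (H7 : ∀ (n : ℕ) (i : T.I n) (ε₀ ε₁ : ℝ), 0 < ε₁ → ∀ V : (T.fam n i).Bdry, (T.fam n i).Reg7 ε₁ V →
      ∀ U₀ : (T.fam n i).Cfg, (T.fam n i).Sat14 C₁ B₃ ε₁ V U₀ →
        (ε₀ ≤ a₀ → B₃ * ε₁ ≤ ε₀ → (T.fam n i).toVarProblemX.AtMostOneCriticalOrbit ε₀ V) ∧
        (ε₁ ≤ a₁' → ∃ U : (T.fam n i).Cfg, (T.fam n i).OnMinimalOrbit (O₁ * C₁ * B₃ * ε₁) V U))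
    (H8 : ∀ i : (Σ n, T.I n), ∀ ε₀ ε₁ : ℝ, 0 < ε₁ → ∀ V : (T.famAllX i).Bdry, ∀ U : (T.famAllX i).Cfg,
      (T.famAllX i).Reg7 ε₁ V → (T.famAllX i).InU ε₀ U → (T.famAllX i).InB V U → (T.famAllX i).IsCritical V U →
        ε₀ ≤ a₅ → (T.famAllX i).InU (B₃ * ε₁) U)
    (HF : ∀ i : (Σ n, T.I n), ∀ ε₁ : ℝ, ∀ V : (T.famAllX i).Bdry, ∀ U : (T.famAllX i).Cfg, 0 < ε₁ → ε₁ ≤ aF →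
      (T.famAllX i).Reg7 ε₁ V → (T.famAllX i).InU (B₃ * ε₁) U → (T.famAllX i).InB V U →
        (T.famAllX i).IsCritical V U →
          ∀ c : (T.famAllX i).Cube, (T.famAllX i).sizeM c ≤ RM * (aF / ε₁) →
            Regularity (T.famAllX i).toVarProblem B₃ B₄ ε₁ U c)
    (n : ℕ) (i : T.I n) (ε₁ : ℝ) (hε₁ : 0 < ε₁) (hε₁a : ε₁ ≤ a₁) (V : (T.fam n i).Bdry)
    (hV : (T.fam n i).Reg7 ε₁ V) (U₀ : (T.fam n i).Cfg) (h14 : (T.fam n i).Sat14 C₁ B₃ ε₁ V U₀) :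
    Exists8 (T.fam n i).toVarProblem B₃ ε₁ V ∧ Unique6 (T.fam n i).toVarProblem a₀ B₃ ε₁ V ∧
      Reg910 (T.fam n i).toVarProblem B₃ B₄ ε₁ (RM * (a₁ / ε₁)) V := by
  obtain ⟨⟨Lmono, Lmin, Lrestr, Luniq⟩, -⟩ := laws n i
  -- existence (p. 304): Prop 7 gives a minimal orbit in (6) with ε₀ = O(1)C₁B₃ε₁, Prop 8 puts it into (8),
  -- law (iii) restricts minimality to the smaller space
  have hex : Exists8 (T.fam n i).toVarProblem B₃ ε₁ V := by
    obtain ⟨U, hU⟩ := (H7 n i a₀ ε₁ hε₁ V hV U₀ h14).2 (le_trans hε₁a h1)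
    obtain ⟨hc, hIn, hB⟩ := Lmin _ V U hU
    have hε₀a₅ : O₁ * C₁ * B₃ * ε₁ ≤ a₅ := by
      have hKa : a₁ * (O₁ * C₁ * B₃) ≤ a₅ := (le_div_iff₀ hK).1 h3
      have hmon : O₁ * C₁ * B₃ * ε₁ ≤ O₁ * C₁ * B₃ * a₁ := mul_le_mul_of_nonneg_left hε₁a hK.le
      linarith [mul_comm a₁ (O₁ * C₁ * B₃)]
    have h8U := H8 ⟨n, i⟩ (O₁ * C₁ * B₃ * ε₁) ε₁ hε₁ V U hV hIn hB hc hε₀a₅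
    exact ⟨U, h8U, hB, Lrestr _ _ V U hU h8U⟩
  refine ⟨hex, ?_, ?_⟩
  · -- uniqueness (Prop 7, first clause) transported to r2's `UniqueCriticalOrbit` by law (iv)
    intro ε₀ hlo hhi U hU
    obtain ⟨hc, hIn, hB⟩ := Lmin _ V U hU
    have hIn0 : (T.fam n i).InU ε₀ U := Lmono _ _ U hlo hIn
    have hAM := (H7 n i ε₀ ε₁ hε₁ V hV U₀ h14).1 hhi hlo
    exact Luniq ε₀ V U hIn0 hB hc (fun U' h1' h2' h3' => hAM U' U h1' h2' h3' hIn0 hB hc)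
  · -- regularity (Sect. F) for cubes with M ≤ R₁M₁(a₁/ε₁) ≤ R₁M₁(a₁(F)/ε₁)
    intro U hU c hc
    obtain ⟨hcrit, hIn, hB⟩ := Lmin _ V U hU
    have hcF : (T.fam n i).sizeM c ≤ RM * (aF / ε₁) := by
      refine le_trans hc ?_
      have : a₁ / ε₁ ≤ aF / ε₁ := div_le_div_of_nonneg_right h2 hε₁.le
      exact mul_le_mul_of_nonneg_left this hRM.le
    exact HF ⟨n, i⟩ ε₁ V U hε₁ (le_trans hε₁a h2) hV hIn hB hcrit c hcF

/-- **Theorem 1 by induction on k** (p. 279: *"Theorem 1 will be proved by induction with respect to k. … The first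
step of the proof, for k = 1, will be covered by the proof of a general case"*; Sect. A (11)–(14)).  Kernel-checked
architecture: from the leaves `StepA11` ((11) ⇒ (7)), `StepA13` ((12) ⇒ (13)), `BaseK1` (k = 1: U₀ = V₀), Proposition 7
as proved from a background (`Prop7From14` with C₁ = L³), Proposition 8 and the Sect. F conclusion (b11's
`B11.Prop8Printed`, `B11.SectFPrinted`, over all levels at once) and the dictionary laws, ONE block of constants
(a₀, a₁, B₃, B₄, M(·)) — fixed before the level — makes Theorem 1 hold at EVERY level: the inductive hypothesis at
level k − 1 is consumed only through (12) with the final constants B₃, a₁ (p. 279: "We assume that ε₁ ≤ a₁,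
B₃ε₁ ≤ ε₀ ≤ a₀ and we use the inductive assumption"), and (13) ⇒ (14) is law (v) with C₁ε₁ = L³ε₁ > 0.  The k = 1 case
is the general step fed with the background of `BaseK1`, as printed.  Census C-pv12-3 (uniformity in k is consistent
exactly because every leaf constant is level-free). [folklore] -/
theorem thm1At_allLevels (T : Tower) (B₃ : ℝ) (hB₃ : 0 < B₃) (hL : 1 ≤ T.L)
    (laws : ∀ n i, (T.fam n i).LawsA) (hA11 : StepA11 T) (hA13 : StepA13 T B₃) (hK1 : BaseK1 T B₃)
    (h7 : Prop7From14 T B₃ (T.L ^ 3)) (h8 : Prop8Printed B₃ T.famAllX) (hF : SectFPrinted B₃ T.famAllX) :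
    ∃ C : Consts, C.B₃ = B₃ ∧ ∀ (n : ℕ) (i : T.I n), Thm1At C (T.fam n i).toVarProblem := by
  obtain ⟨a₀, a₁', O₁, ha₀, ha₁', hO₁, H7⟩ := h7
  obtain ⟨a₅, ha₅, H8⟩ := h8
  obtain ⟨aF, B₄, RM, haF, hB₄, hRM, HF⟩ := hF
  have hLpos : 0 < T.L := lt_of_lt_of_le one_pos hL
  have hK : 0 < O₁ * T.L ^ 3 * B₃ := by positivity
  -- the final a₁ of p. 304
  set a₁ : ℝ := min (min a₁' aF) (min (a₅ / (O₁ * T.L ^ 3 * B₃)) (a₀ / B₃)) with ha₁def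
  have ha₁pos : 0 < a₁ := by
    simp only [ha₁def, lt_min_iff]
    exact ⟨⟨ha₁', haF⟩, div_pos ha₅ hK, div_pos ha₀ hB₃⟩
  have h1 : a₁ ≤ a₁' := le_trans (min_le_left _ _) (min_le_left _ _)
  have h2 : a₁ ≤ aF := le_trans (min_le_left _ _) (min_le_right _ _)
  have h3 : a₁ ≤ a₅ / (O₁ * T.L ^ 3 * B₃) := le_trans (min_le_right _ _) (min_le_left _ _)
  have h4 : a₁ ≤ a₀ / B₃ := le_trans (min_le_right _ _) (min_le_right _ _)
  have hB₃a₁ : B₃ * a₁ ≤ a₀ := by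
    have := (le_div_iff₀ hB₃).1 h4
    linarith [mul_comm B₃ a₁]
  have hMpos : ∀ e : ℝ, 0 < e → 0 < RM * (a₁ / e) := by
    intro e he
    positivity
  -- the level-free step: Theorem 1's clauses at (n, i, ε₁, V) from a background U₀ with (14), C₁ = L³
  have step := thm1_clauses_of_background T B₃ (T.L ^ 3) a₀ a₁' O₁ a₅ aF B₄ RM a₁ hK hRM h1 h2 h3 laws H7 H8 HF
  refine ⟨⟨a₀, a₁, B₃, B₄, fun e => RM * (a₁ / e), ha₀, ha₁pos, hB₃, hB₄, hB₃a₁, hMpos⟩, rfl, ?_⟩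
  intro n
  induction n with
  | zero =>
      -- k = 1: "we take simply U₀ = V₀" and run the general step
      intro i ε₁ hε₁ hε₁a V hV
      exact step 0 i ε₁ hε₁ hε₁a V hV (T.base i V) (hK1 i ε₁ V hε₁ hV)
  | succ n ih =>
      -- k ↦ k + 1: V₀ by (11), U_{k}(V₀) by the inductive hypothesis (12), lifted to Ω₀ by (13), hence (14)
      intro i ε₁ hε₁ hε₁a V hV
      have hV₀ : (T.fam n (T.drop n i)).Reg7 ε₁ (T.V0 n i V) := hA11 n i ε₁ V hV
      obtain ⟨U', hU'in, hU'B, -⟩ := (ih (T.drop n i) ε₁ hε₁ hε₁a (T.V0 n i V) hV₀).1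
      obtain ⟨h13U, h13B⟩ := hA13 n i ε₁ V U' hV hU'in hU'B
      have h14 : (T.fam (n + 1) i).Sat14 (T.L ^ 3) B₃ ε₁ V (T.lift n i U') :=
        ⟨h13U, (laws (n + 1) i).2 _ V _ (by positivity) h13B⟩
      exact step (n + 1) i ε₁ hε₁ hε₁a V hV (T.lift n i U') h14

/-- **Theorem 1 with constants uniform in k**: under the leaves of `thm1At_allLevels`, r2's `B11.Thm1Printed` holds for
the family of ALL levels of the tower at once (one block of constants a₀, a₁, B₃, B₄, M(·) for every k — "depend on d
and L only"). [folklore] -/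
theorem thm1Printed_allLevels (T : Tower) (B₃ : ℝ) (hB₃ : 0 < B₃) (hL : 1 ≤ T.L)
    (laws : ∀ n i, (T.fam n i).LawsA) (hA11 : StepA11 T) (hA13 : StepA13 T B₃) (hK1 : BaseK1 T B₃)
    (h7 : Prop7From14 T B₃ (T.L ^ 3)) (h8 : Prop8Printed B₃ T.famAllX) (hF : SectFPrinted B₃ T.famAllX) :
    Thm1Printed T.famAll := by
  obtain ⟨C, -, H⟩ := thm1At_allLevels T B₃ hB₃ hL laws hA11 hA13 hK1 h7 h8 hF
  exact (thm1Printed_iff T.famAll).2 ⟨C, fun p => H p.1 p.2⟩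

/-- … in particular at each single level k = n + 1 (the statement consumed downstream per k). [folklore] -/
theorem thm1Printed_level (T : Tower) (B₃ : ℝ) (hB₃ : 0 < B₃) (hL : 1 ≤ T.L)
    (laws : ∀ n i, (T.fam n i).LawsA) (hA11 : StepA11 T) (hA13 : StepA13 T B₃) (hK1 : BaseK1 T B₃)
    (h7 : Prop7From14 T B₃ (T.L ^ 3)) (h8 : Prop8Printed B₃ T.famAllX) (hF : SectFPrinted B₃ T.famAllX) (n : ℕ) :
    Thm1Printed (fun i : T.I n => (T.fam n i).toVarProblem) := by
  obtain ⟨C, -, H⟩ := thm1At_allLevels T B₃ hB₃ hL laws hA11 hA13 hK1 h7 h8 hF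
  exact (thm1Printed_iff _).2 ⟨C, fun i => H n i⟩

/-- Conversely, the background supply of Sect. A is itself a consequence of Theorem 1 at all levels plus the leaves
(11), (13) and the k = 1 sentence: every V with (7), ε₁ ≤ a₁, admits a U₀ with (14), C₁ = L³ — so that, with
`prop7Printed_of_from14`, b11's background-free `B11.Prop7Printed` is recovered for ε₁ ≤ a₁ once the induction has
closed (GAPS G-pv12-1: the printed Proposition 7 is a node INSIDE the induction, not a standalone input). [folklore] -/
theorem background_of_thm1At (T : Tower) (C : Consts) (laws : ∀ n i, (T.fam n i).LawsA) (hLpos : 0 < T.L)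
    (hA11 : StepA11 T) (hA13 : StepA13 T C.B₃) (hK1 : BaseK1 T C.B₃)
    (H : ∀ (n : ℕ) (i : T.I n), Thm1At C (T.fam n i).toVarProblem)
    (n : ℕ) (i : T.I n) (ε₁ : ℝ) (hε₁ : 0 < ε₁) (hε₁a : ε₁ ≤ C.a₁) (V : (T.fam n i).Bdry)
    (hV : (T.fam n i).Reg7 ε₁ V) : ∃ U₀ : (T.fam n i).Cfg, (T.fam n i).Sat14 (T.L ^ 3) C.B₃ ε₁ V U₀ := by
  cases n with
  | zero => exact ⟨T.base i V, hK1 i ε₁ V hε₁ hV⟩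
  | succ n =>
      have hV₀ : (T.fam n (T.drop n i)).Reg7 ε₁ (T.V0 n i V) := hA11 n i ε₁ V hV
      obtain ⟨U', hU'in, hU'B, -⟩ := (H n (T.drop n i) ε₁ hε₁ hε₁a (T.V0 n i V) hV₀).1
      obtain ⟨h13U, h13B⟩ := hA13 n i ε₁ V U' hV hU'in hU'B
      exact ⟨T.lift n i U', h13U, (laws (n + 1) i).2 _ V _ (by positivity) h13B⟩

end Literature.MathematicalPhysics.QuantumFieldTheory.Balaban1983to89.B11Thm1
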